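import Literature.Probability.RandomPlanarGeometry.RadialBesselLifetime
import Mathlib.Analysis.SpecialFunctions.Integrability.Basic
import HarnessLib

/-!
# The radial Bessel process of SLE_κ: the exit probabilities through the scale function

Topic `Probability/RandomPlanarGeometry`; theorems, with two auxiliary definitions (the scale
function `sleScale` and the event `sleExitsBot`), sequel of `RadialBesselLifetime`. For `κ > 4`
and the radial Bessel process `dYₜ = cot(Yₜ/2) dt - √κ dBₜ` of SLE_κ from `θ ∈ (0, 2π)` (LSW
(2002), (2.11); Lawler (2005), (1.16) with `a = 2/κ`), Lawler's **scale function**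
`ψ(x) = ∫_π^x e^{-V(u)} du`, `V(x) = 2a log sin(x/2)`, i.e. `ψ(x) = ∫_π^x sin(u/2)^{-4/κ} du`
(§1.11, p. 35; Lemma 1.27: `ψ(x) = ∫ [sin(y/2)]^{-2a} dy`), is finite on `[0, 2π]` exactly when
`κ > 4` and solves `ψ'' + v ψ' = 0`, i.e. `(κ/2) ψ'' + cot(x/2) ψ' = 0` in the time scale of
(2.11). We prove:

* `sleScale κ` (definition), its integrability on `[0, 2π]` for `κ > 4` (comparison with
  `u^{-4/κ}`, Jordan's inequality), continuity on `[0, 2π]`, `C²` on `(0, 2π)`, strict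
  monotonicity, and `Λ₀ (sleScale κ) = 0` (`expGenerator_sleScale`);
* `measureReal_sleExitsTop_add_sleExitsBot` — `P[Y_T = 2π] + P[Y_T = 0] = 1` (`T < ∞` a.s. and
  the exit dichotomy);
* `measureReal_sleExitsTop_eq` — **Lawler's Lemma 1.25 for this process**:
  `P[Y_T = 2π] = (ψ(θ) - ψ(0)) / (ψ(2π) - ψ(0))` (optional stopping of the martingale `ψ(Y_{t∧σₙ})`,
  `t → ∞`, `n → ∞` by bounded convergence), in particular both exits have positive probability
  (Lemma 1.25: "`P^x{T < ∞; X_T = 0} > 0` iff `ψ(0+) > -∞`"; LSW (2002), §4: "a.s. … the path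
  `γ[0, t]` intersects `A_θ` … by comparing with a Bessel process").

## References

* G. F. Lawler, *Conformally Invariant Processes in the Plane*, AMS (2005), §1.11: Lemma 1.25 and
  its proof, Lemma 1.27. [Lawler2005]
* G. F. Lawler, O. Schramm, W. Werner, *One-arm exponent for critical 2D percolation*, Electron.
  J. Probab. 7 (2002), no. 2, §2 (2.11), §4 (p. 9). [LawlerSchrammWernerEJP2002]
-/

noncomputable section

open MeasureTheory ProbabilityTheory Filter Topology Set
open scoped NNReal ENNReal

namespace Literature.Probability.RandomPlanarGeometry

namespace RadialLoewner

open Literature.Probability.Process Literature.Analysis.FunctionSpaces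
open Literature.Probability.Percolation (sin_quarter_pos)

/-! ### The scale function `ψ(x) = ∫_π^x sin(u/2)^{-4/κ} du` -/

/-- The scale density `e^{-V(u)} = sin(u/2)^{-4/κ}` (Lawler (2005), §1.11, with
`V(x) = 2a log sin(x/2)`, `a = 2/κ`). [cite: Lawler2005, §1.11 Lemma 1.27] -/
def sleScaleDensity (κ : ℝ≥0) (u : ℝ) : ℝ :=
  Real.sin (u / 2) ^ (-(4 : ℝ) / κ)

/-- **Lawler's scale function** `ψ(x) = ∫_π^x sin(u/2)^{-4/κ} du` of the radial Bessel process
(Lawler (2005), §1.11, p. 35: "`ψ(x) = ∫_π^x e^{-V(u)} du` … strictly increasing and satisfies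
`ψ'' + v ψ' = 0`"; Lemma 1.27). [cite: Lawler2005, §1.11 Lemma 1.27] -/
def sleScale (κ : ℝ≥0) (x : ℝ) : ℝ :=
  ∫ u in Real.pi..x, sleScaleDensity κ u

variable {κ : ℝ≥0}

/-- The scale density is positive on `(0, 2π)`. [folklore] -/
theorem sleScaleDensity_pos (κ : ℝ≥0) {u : ℝ} (hu : u ∈ Ioo 0 (2 * Real.pi)) :
    0 < sleScaleDensity κ u :=
  Real.rpow_pos_of_pos (sin_half_pos hu) _

/-- The scale density is nonnegative. [folklore] -/
theorem sleScaleDensity_nonneg (κ : ℝ≥0) {u : ℝ} (hu : u ∈ Icc 0 (2 * Real.pi)) :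
    0 ≤ sleScaleDensity κ u :=
  Real.rpow_nonneg (Real.sin_nonneg_of_nonneg_of_le_pi (by linarith [hu.1]) (by linarith [hu.2])) _

/-- The scale density is continuous on `(0, 2π)`. [folklore] -/
theorem continuousOn_sleScaleDensity (κ : ℝ≥0) :
    ContinuousOn (sleScaleDensity κ) (Ioo 0 (2 * Real.pi)) := fun _ hu ↦
  ((Real.continuous_sin.comp (continuous_id.div_const _)).continuousAt.rpow_const
    (Or.inl (sin_half_pos hu).ne')).continuousWithinAt

/-- The scale density is symmetric about `π`: `e^{-V(2π - u)} = e^{-V(u)}`. [folklore] -/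
theorem sleScaleDensity_two_pi_sub (κ : ℝ≥0) (u : ℝ) :
    sleScaleDensity κ (2 * Real.pi - u) = sleScaleDensity κ u := by
  rw [sleScaleDensity, sleScaleDensity, show (2 * Real.pi - u) / 2 = Real.pi - u / 2 by ring, Real.sin_pi_sub]

/-- The scale density is measurable. [folklore] -/
theorem measurable_sleScaleDensity (κ : ℝ≥0) : Measurable (sleScaleDensity κ) :=
  (Real.measurable_sin.comp (measurable_id.div_const _)).pow_const _

/-- **Domination near `0`**: `sin(u/2)^{-4/κ} ≤ (u/π)^{-4/κ}` on `(0, π]` (Jordan's inequality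
`sin x ≥ 2x/π` on `[0, π/2]`). [folklore] -/
theorem sleScaleDensity_le {u : ℝ} (hu : u ∈ Ioc 0 Real.pi) :
    sleScaleDensity κ u ≤ (u / Real.pi) ^ (-(4 : ℝ) / κ) := by
  have hJ : 2 / Real.pi * (u / 2) ≤ Real.sin (u / 2) := Real.mul_le_sin (by linarith [hu.1]) (by linarith [hu.2])
  have heq : 2 / Real.pi * (u / 2) = u / Real.pi := by ring
  rw [heq] at hJ
  exact Real.rpow_le_rpow_of_nonpos (by have := Real.pi_pos; exact div_pos hu.1 this) hJ
    (div_nonpos_of_nonpos_of_nonneg (by norm_num) κ.coe_nonneg)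

/-- **The scale density is integrable on `[0, π]` for `κ > 4`** (exponent `-4/κ > -1`). [folklore] -/
theorem intervalIntegrable_sleScaleDensity_left (hκ : 4 < κ) :
    IntervalIntegrable (sleScaleDensity κ) volume 0 Real.pi := by
  have hκ' : (4 : ℝ) < κ := by exact_mod_cast hκ
  have hr : -1 < -(4 : ℝ) / κ := by
    rw [neg_div, neg_lt_neg_iff, div_lt_one (by linarith)]; exact hκ'
  -- the dominating function `π^{4/κ} u^{-4/κ} = (u/π)^{-4/κ}`
  set r : ℝ := -(4 : ℝ) / κ with hrdef
  have hdom : IntervalIntegrable (fun u : ℝ ↦ (Real.pi ^ r)⁻¹ * u ^ r) volume 0 Real.pi :=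
    (intervalIntegral.intervalIntegrable_rpow' hr).const_mul _
  refine hdom.mono_fun' (measurable_sleScaleDensity κ).aestronglyMeasurable ?_
  rw [EventuallyLE, ae_restrict_iff' measurableSet_uIoc]
  refine ae_of_all _ fun u hu ↦ ?_
  rw [uIoc_of_le Real.pi_pos.le] at hu
  rw [Real.norm_eq_abs, abs_of_nonneg (sleScaleDensity_nonneg κ ⟨hu.1.le, by linarith [hu.2, Real.pi_pos]⟩)]
  calc sleScaleDensity κ u ≤ (u / Real.pi) ^ r := sleScaleDensity_le hu
    _ = (Real.pi ^ r)⁻¹ * u ^ r := by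
        rw [Real.div_rpow hu.1.le Real.pi_pos.le, div_eq_inv_mul]

/-- **The scale density is integrable on `[0, 2π]` for `κ > 4`** (symmetry about `π` for the
right half). [cite: Lawler2005, §1.11 Lemma 1.27] -/
theorem intervalIntegrable_sleScaleDensity (hκ : 4 < κ) (a b : ℝ) (ha : a ∈ Icc 0 (2 * Real.pi))
    (hb : b ∈ Icc 0 (2 * Real.pi)) : IntervalIntegrable (sleScaleDensity κ) volume a b := by
  have hleft := intervalIntegrable_sleScaleDensity_left hκ
  have hright : IntervalIntegrable (sleScaleDensity κ) volume Real.pi (2 * Real.pi) := by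
    have h := (hleft.comp_sub_left (2 * Real.pi)).symm
    simp only [sleScaleDensity_two_pi_sub, sub_zero, show 2 * Real.pi - Real.pi = Real.pi by ring] at h
    exact h
  have hall : IntervalIntegrable (sleScaleDensity κ) volume 0 (2 * Real.pi) := hleft.trans hright
  exact (hall.mono_set (by
    rw [uIcc_of_le (by linarith [Real.pi_pos] : (0 : ℝ) ≤ 2 * Real.pi)]
    exact uIcc_subset_Icc ha hb))

/-- **`ψ` is continuous on `[0, 2π]`** (`κ > 4`). [cite: Lawler2005, §1.11 Lemma 1.27] -/
theorem continuousOn_sleScale (hκ : 4 < κ) : ContinuousOn (sleScale κ) (Icc 0 (2 * Real.pi)) := by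
  have h := intervalIntegral.continuousOn_primitive_interval' (μ := volume) (f := sleScaleDensity κ)
    (b₁ := 0) (b₂ := 2 * Real.pi) (a := Real.pi)
    (intervalIntegrable_sleScaleDensity hκ 0 (2 * Real.pi) ⟨le_rfl, by linarith [Real.pi_pos]⟩
      ⟨by linarith [Real.pi_pos], le_rfl⟩)
    (by rw [uIcc_of_le (by linarith [Real.pi_pos])]; exact ⟨Real.pi_pos.le, by linarith [Real.pi_pos]⟩)
  rw [uIcc_of_le (by linarith [Real.pi_pos])] at h
  exact h

/-- **`ψ' = e^{-V}` on `(0, 2π)`.** [folklore] -/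
theorem hasDerivAt_sleScale (hκ : 4 < κ) {x : ℝ} (hx : x ∈ Ioo 0 (2 * Real.pi)) :
    HasDerivAt (sleScale κ) (sleScaleDensity κ x) x := by
  have hint : IntervalIntegrable (sleScaleDensity κ) volume Real.pi x :=
    intervalIntegrable_sleScaleDensity hκ _ _ ⟨Real.pi_pos.le, by linarith [Real.pi_pos]⟩
      ⟨hx.1.le, hx.2.le⟩
  have hcont : ContinuousAt (sleScaleDensity κ) x :=
    (continuousOn_sleScaleDensity κ).continuousAt (Ioo_mem_nhds hx.1 hx.2)
  exact intervalIntegral.integral_hasDerivAt_right hint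
    ((measurable_sleScaleDensity κ).stronglyMeasurable.stronglyMeasurableAtFilter) hcont

/-- `deriv ψ = e^{-V}` near every point of `(0, 2π)`. [folklore] -/
theorem deriv_sleScale_eventuallyEq (hκ : 4 < κ) {x : ℝ} (hx : x ∈ Ioo 0 (2 * Real.pi)) :
    deriv (sleScale κ) =ᶠ[𝓝 x] sleScaleDensity κ := by
  filter_upwards [Ioo_mem_nhds hx.1 hx.2] with y hy
  exact (hasDerivAt_sleScale hκ hy).deriv

/-- **`ψ` is strictly increasing on `[0, 2π]`** (`κ > 4`; positive derivative inside).
[cite: Lawler2005, §1.11 Lemma 1.27] -/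
theorem strictMonoOn_sleScale (hκ : 4 < κ) : StrictMonoOn (sleScale κ) (Icc 0 (2 * Real.pi)) :=
  strictMonoOn_of_deriv_pos (convex_Icc _ _) (continuousOn_sleScale hκ) fun x hx ↦ by
    rw [interior_Icc] at hx
    rw [(hasDerivAt_sleScale hκ hx).deriv]
    exact sleScaleDensity_pos κ hx

/-- `ψ` is `C²` on `(0, 2π)` (its derivative `sin(·/2)^{-4/κ}` is smooth there). [folklore] -/
theorem contDiffOn_sleScale (hκ : 4 < κ) : ContDiffOn ℝ 2 (sleScale κ) (Ioo 0 (2 * Real.pi)) := by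
  have h1 : ContDiffOn ℝ 1 (sleScaleDensity κ) (Ioo 0 (2 * Real.pi)) :=
    (contDiffOn_sinPow 2 (fun _ hy ↦ sin_half_pos hy)).of_le (by norm_num)
  rw [show (2 : WithTop ℕ∞) = 1 + 1 from rfl,
    contDiffOn_succ_iff_deriv_of_isOpen isOpen_Ioo]
  refine ⟨fun x hx ↦ (hasDerivAt_sleScale hκ hx).differentiableAt.differentiableWithinAt, by simp, ?_⟩
  exact h1.congr fun x hx ↦ (hasDerivAt_sleScale hκ hx).deriv

/-- **`Λ₀ ψ = 0` on `(0, 2π)`**: `(κ/2) ψ'' + cot(x/2) ψ' = 0` (Lawler (2005), §1.11: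
"`ψ'' + v ψ' = 0`", `v = a cot(x/2)`, after the time change). With `g = ψ' = sin(x/2)^{-4/κ}`,
`g' = (-4/κ) g cos(x/2)/(2 sin(x/2))`, so `(κ/2) g' = -g cot(x/2)`. [cite: Lawler2005, §1.11 Lemma 1.27] -/
theorem expGenerator_sleScale (hκ : 4 < κ) {x : ℝ} (hx : x ∈ Ioo 0 (2 * Real.pi)) :
    expGenerator κ 0 (sleScale κ) x = 0 := by
  have hκ' : (4 : ℝ) < κ := by exact_mod_cast hκ
  have hκ0 : (κ : ℝ) ≠ 0 := by positivity
  have hv := sin_half_pos hx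
  have h1 : deriv (sleScale κ) x = sleScaleDensity κ x := (hasDerivAt_sleScale hκ hx).deriv
  have h2 : iteratedDeriv 2 (sleScale κ) x =
      (-(4 : ℝ) / κ) * Real.sin (x / 2) ^ (-(4 : ℝ) / κ) * Real.cos (x / 2) / (2 * Real.sin (x / 2)) := by
    rw [iteratedDeriv_succ, iteratedDeriv_one, (deriv_sleScale_eventuallyEq hκ hx).deriv_eq]
    exact (hasDerivAt_sinPow (m := 2) (q := -(4 : ℝ) / κ) hv).deriv
  rw [expGenerator_apply, h1, h2, sleScaleDensity, Real.cot_eq_cos_div_sin, zero_mul, add_zero]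
  field_simp
  ring

/-! ### The bottom exit event and the exit probabilities -/

/-- **The event `{Y_T = 0}`** that the radial Bessel process of SLE_κ from `θ` leaves `(0, 2π)`
through `0` (LSW's `ν = -1`, p. 5; on `{T < ∞}`), as a set of Brownian paths.
[cite: LawlerSchrammWernerEJP2002, §2 p. 5] -/
def sleExitsBot (κ : ℝ≥0) (θ : ℝ) : Set (ℝ≥0 → ℝ) :=
  {ω | ExitsBot (sleDriving κ) (continuous_sleDriving' κ) θ ω}

variable {θ : ℝ} {n : ℕ}

/-- `{Y_T = 0}` is measurable. [folklore] -/
theorem measurableSet_sleExitsBot (κ : ℝ≥0) (θ : ℝ) : MeasurableSet (sleExitsBot κ θ) :=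
  measurableSet_exitsBot (continuous_sleDriving' κ) (measurable_sleDriving_filtration κ) θ

/-- The two exit events are disjoint. [folklore] -/
theorem disjoint_sleExitsTop_sleExitsBot (κ : ℝ≥0) (θ : ℝ) :
    Disjoint (sleExitsTop κ θ) (sleExitsBot κ θ) :=
  Set.disjoint_left.2 fun ω htop hbot ↦
    not_exitsTop_and_exitsBot (continuous_sleDriving' κ) θ ω ⟨htop, hbot⟩

/-- Almost surely one of the two exit events occurs (`T < ∞` a.s. and the dichotomy; `κ > 4`,
`θ ∈ (0, 2π)`). [folklore] -/
theorem ae_mem_sleExitsTop_or_sleExitsBot (hκ : 4 < κ) (hθ : θ ∈ Ioo 0 (2 * Real.pi)) :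
    ∀ᵐ ω ∂preWienerMeasure, ω ∈ sleExitsTop κ θ ∨ ω ∈ sleExitsBot κ θ := by
  filter_upwards [ae_sleLifetime_lt_top (θ := θ) hκ] with ω hT
  exact exitsTop_or_exitsBot (continuous_sleDriving' κ) hθ hT

/-- **`P[Y_T = 2π] + P[Y_T = 0] = 1`** (`κ > 4`, `θ ∈ (0, 2π)`). [cite: Lawler2005, §1.11 Lemma 1.27] -/
theorem measureReal_sleExitsTop_add_sleExitsBot (hκ : 4 < κ) (hθ : θ ∈ Ioo 0 (2 * Real.pi)) :
    preWienerMeasure.real (sleExitsTop κ θ) + preWienerMeasure.real (sleExitsBot κ θ) = 1 := by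
  haveI := isProbabilityMeasure_preWienerMeasure'
  rw [← measureReal_union (disjoint_sleExitsTop_sleExitsBot κ θ) (measurableSet_sleExitsBot κ θ)]
  have : preWienerMeasure.real (sleExitsTop κ θ ∪ sleExitsBot κ θ) = preWienerMeasure.real univ := by
    refine measureReal_congr ?_
    rw [ae_eq_univ]
    have h := ae_mem_sleExitsTop_or_sleExitsBot hκ hθ
    rw [ae_iff] at h
    convert h using 2
    ext ω; simp
  rw [this, probReal_univ]

/-- A global `C²` function agreeing with `ψ` near `[2δₙ, 2π - 2δₙ]`. [folklore] -/
theorem exists_contDiff_sleScale (hκ : 4 < κ) (n : ℕ) :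
    ∃ F : ℝ → ℝ, ContDiff ℝ 2 F ∧ ∀ y ∈ Ioo (level n) (2 * Real.pi - level n), F =ᶠ[𝓝 y] sleScale κ :=
  exists_contDiff_eventuallyEq (contDiffOn_sleScale hκ) (level_pos n) (level_lt_pi n)

/-- **Step 1: `E[ψ(Y^{δₙ}(σₙ))] = ψ(θ)`** for a level `n` containing `θ` (`κ > 4`): optional
stopping of the martingale `ψ(Y_{t∧σₙ})` (`integral_expClock_mul_eq_self` with `μ = 0`) and
bounded convergence `t → ∞` (`σₙ < ∞` a.s., `ψ` bounded on `[0, 2π]`).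
[cite: Lawler2005, §1.11 Lemma 1.25] -/
theorem integral_sleScale_sleExitLevelValue (hκ : 4 < κ)
    (hθn : θ ∈ Ioo (2 * level n) (2 * Real.pi - 2 * level n)) :
    ∫ ω, sleScale κ (sleExitLevelValue κ n θ ω) ∂preWienerMeasure = sleScale κ θ := by
  haveI := isProbabilityMeasure_preWienerMeasure'
  obtain ⟨F, hF, hFeq⟩ := exists_contDiff_sleScale hκ n
  have hFval : ∀ y ∈ Icc (2 * level n) (2 * Real.pi - 2 * level n), F y = sleScale κ y :=
    fun y hy ↦ (hFeq y (Icc_level_subset_Ioo_level n hy)).eq_of_nhds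
  have hgen : ∀ y ∈ Icc (2 * level n) (2 * Real.pi - 2 * level n), expGenerator κ 0 F y = 0 := by
    intro y hy
    rw [expGenerator_congr (hFeq y (Icc_level_subset_Ioo_level n hy))]
    exact expGenerator_sleScale hκ (Icc_level_subset_Ioo n hy)
  have hθmem : θ ∈ Icc (2 * level n) (2 * Real.pi - 2 * level n) := ⟨hθn.1.le, hθn.2.le⟩
  -- bound of `ψ` on `[0, 2π]`
  obtain ⟨C, hC⟩ := isCompact_Icc.exists_bound_of_continuousOn (continuousOn_sleScale hκ)
  set G : ℕ → (ℝ≥0 → ℝ) → ℝ := fun k ω ↦ expClock κ n θ 0 k ω *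
    F (stoppedProcess (sleArgLevel κ n θ) (sleExitLevel κ n θ) k ω) with hG
  have hint : ∀ k : ℕ, ∫ ω, G k ω ∂preWienerMeasure = sleScale κ θ := by
    intro k
    rw [← hFval θ hθmem]
    exact integral_expClock_mul_eq_self hθn hF hgen k
  have hclock : ∀ k ω, expClock κ n θ 0 (k : ℝ≥0) ω = 1 := fun k ω ↦ by
    rw [expClock_apply, zero_mul, Real.exp_zero]
  have hlim : ∀ᵐ ω ∂preWienerMeasure, Tendsto (fun k : ℕ ↦ G k ω) atTop
      (𝓝 (sleScale κ (sleExitLevelValue κ n θ ω))) := by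
    filter_upwards [ae_sleExitLevel_lt_top hκ n θ] with ω hω
    obtain ⟨s, hs⟩ := WithTop.ne_top_iff_exists.1 hω.ne
    refine tendsto_const_nhds.congr' ?_
    filter_upwards [eventually_stoppedProcess_eq_sleExitLevelValue hs.symm] with k hk
    simp only [hG, hk, hclock, one_mul]
    have hmem : sleExitLevelValue κ n θ ω ∈ Icc (2 * level n) (2 * Real.pi - 2 * level n) := by
      rcases sleExitLevelValue_eq_or hθn hs.symm with h | h <;> rw [h]
      · exact ⟨le_rfl, by have := level_le_one n; linarith [Real.pi_gt_three]⟩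
      · exact ⟨by have := level_le_one n; linarith [Real.pi_gt_three], le_rfl⟩
    exact (hFval _ hmem).symm
  have hmeas : ∀ k : ℕ, AEStronglyMeasurable (G k) preWienerMeasure := fun k ↦
    (measurable_expClock_mul hF 0 k).aestronglyMeasurable
  have hbound : ∀ k : ℕ, ∀ᵐ ω ∂preWienerMeasure, ‖G k ω‖ ≤ C := fun k ↦ ae_of_all _ fun ω ↦ by
    have hVmem := stoppedProcess_sleArgLevel_mem_Icc (κ := κ) hθn (k : ℝ≥0) ω
    rw [hG]
    simp only [hclock, one_mul]
    rw [hFval _ hVmem]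
    exact hC _ (Icc_level_subset_Icc n hVmem)
  have hdct := tendsto_integral_of_dominated_convergence _ hmeas (integrable_const C) hbound hlim
  exact tendsto_nhds_unique hdct (by simp only [hint]; exact tendsto_const_nhds)

/-- **Step 2: `ψ(Y^{δₙ}(σₙ)) → ψ(2π) 𝟙_{Y_T = 2π} + ψ(0) 𝟙_{Y_T = 0}`** on `{T < ∞}` (`κ > 4`,
`θ ∈ (0, 2π)`): the exit dichotomy and the continuity of `ψ` on `[0, 2π]`. [folklore] -/
theorem tendsto_sleScale_sleExitLevelValue (hκ : 4 < κ) (hθ : θ ∈ Ioo 0 (2 * Real.pi))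
    {ω : ℝ≥0 → ℝ} (hT : sleLifetime κ θ ω < ⊤) :
    Tendsto (fun n ↦ sleScale κ (sleExitLevelValue κ n θ ω)) atTop
      (𝓝 ((sleExitsTop κ θ).indicator (fun _ ↦ sleScale κ (2 * Real.pi)) ω +
        (sleExitsBot κ θ).indicator (fun _ ↦ sleScale κ 0) ω)) := by
  have hcont := continuousOn_sleScale hκ
  have hfin : ∀ n, ∃ s : ℝ≥0, sleExitLevel κ n θ ω = s := fun n ↦ by
    have hle : sleExitLevel κ n θ ω ≤ sleLifetime κ θ ω :=
      exitLevel_le_lifetime (continuous_sleDriving' κ) n θ ω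
    have hne : sleExitLevel κ n θ ω ≠ ⊤ := (hle.trans_lt hT).ne
    obtain ⟨s, hs⟩ := WithTop.ne_top_iff_exists.1 hne
    exact ⟨s, hs.symm⟩
  have h2lev : Tendsto (fun n : ℕ ↦ 2 * level n) atTop (𝓝 0) := by
    simpa using tendsto_level.const_mul 2
  have hlevmem : ∀ n, 2 * level n ∈ Icc 0 (2 * Real.pi) := fun n ↦
    ⟨by have := level_pos n; positivity, by have := level_le_one n; linarith [Real.pi_gt_three]⟩
  have hlevmem' : ∀ n, 2 * Real.pi - 2 * level n ∈ Icc 0 (2 * Real.pi) := fun n ↦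
    ⟨by have := level_le_one n; linarith [Real.pi_gt_three], by have := level_pos n; linarith⟩
  rcases exitsTop_or_exitsBot (continuous_sleDriving' κ) hθ hT with htop | hbot
  · have hmem : ω ∈ sleExitsTop κ θ := htop
    have hnmem : ω ∉ sleExitsBot κ θ := fun hb ↦
      not_exitsTop_and_exitsBot (continuous_sleDriving' κ) θ ω ⟨htop, hb⟩
    rw [indicator_of_mem hmem, indicator_of_notMem hnmem, add_zero]
    obtain ⟨N, hN⟩ := htop
    have hlimv : Tendsto (fun n : ℕ ↦ 2 * Real.pi - 2 * level n) atTop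
        (𝓝[Icc 0 (2 * Real.pi)] (2 * Real.pi)) :=
      tendsto_nhdsWithin_iff.2 ⟨by simpa using tendsto_const_nhds.sub h2lev,
        Eventually.of_forall hlevmem'⟩
    have h := (hcont (2 * Real.pi) ⟨by linarith [Real.pi_pos], le_rfl⟩).tendsto.comp hlimv
    refine h.congr' ?_
    filter_upwards [eventually_ge_atTop N] with n hn
    obtain ⟨s, hs⟩ := hfin n
    simp only [Function.comp_apply]
    rw [(topAt_iff_sleExitLevelValue hs).1 (hN n hn)]
  · have hmem : ω ∈ sleExitsBot κ θ := hbot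
    have hnmem : ω ∉ sleExitsTop κ θ := fun ht ↦
      not_exitsTop_and_exitsBot (continuous_sleDriving' κ) θ ω ⟨ht, hbot⟩
    rw [indicator_of_mem hmem, indicator_of_notMem hnmem, zero_add]
    obtain ⟨N, hN⟩ := hbot
    have hlimv : Tendsto (fun n : ℕ ↦ 2 * level n) atTop (𝓝[Icc 0 (2 * Real.pi)] 0) :=
      tendsto_nhdsWithin_iff.2 ⟨h2lev, Eventually.of_forall hlevmem⟩
    have h := (hcont 0 ⟨le_rfl, by linarith [Real.pi_pos]⟩).tendsto.comp hlimv
    refine h.congr' ?_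
    filter_upwards [eventually_ge_atTop N] with n hn
    obtain ⟨s, hs⟩ := hfin n
    simp only [Function.comp_apply]
    rw [(botAt_iff_sleExitLevelValue hs).1 (hN n hn)]

/-- **Lawler's Lemma 1.25 for the radial Bessel process of SLE_κ** (`κ > 4`, `θ ∈ (0, 2π)`):

  `ψ(2π) P[Y_T = 2π] + ψ(0) P[Y_T = 0] = ψ(θ)`,

with `ψ` the scale function (optional stopping of `ψ(Y_{t∧σₙ})`, `t → ∞`, `n → ∞` by bounded
convergence; Lawler (2005), proof of Lemma 1.25: "`ψ(x) = E^x[M_σ] = P^x{X_σ = y₁} ψ(y₁) +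
P^x{X_σ = y₂} ψ(y₂)`", then `y₁ → 0+`, `y₂ → 2π-`). [cite: Lawler2005, §1.11 Lemma 1.25] -/
theorem sleScale_mul_measureReal_exits (hκ : 4 < κ) (hθ : θ ∈ Ioo 0 (2 * Real.pi)) :
    sleScale κ (2 * Real.pi) * preWienerMeasure.real (sleExitsTop κ θ) +
      sleScale κ 0 * preWienerMeasure.real (sleExitsBot κ θ) = sleScale κ θ := by
  haveI := isProbabilityMeasure_preWienerMeasure'
  obtain ⟨N₀, hN₀⟩ := eventually_mem_Ioo_level hθ
  obtain ⟨C, hC⟩ := isCompact_Icc.exists_bound_of_continuousOn (continuousOn_sleScale hκ)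
  set h : ℕ → (ℝ≥0 → ℝ) → ℝ := fun n ω ↦ sleScale κ (sleExitLevelValue κ (n + N₀) θ ω) with hh
  have hint : ∀ n, ∫ ω, h n ω ∂preWienerMeasure = sleScale κ θ := fun n ↦
    integral_sleScale_sleExitLevelValue hκ (hN₀ (n + N₀) (Nat.le_add_left _ _))
  set lim : (ℝ≥0 → ℝ) → ℝ := fun ω ↦ (sleExitsTop κ θ).indicator (fun _ ↦ sleScale κ (2 * Real.pi)) ω +
    (sleExitsBot κ θ).indicator (fun _ ↦ sleScale κ 0) ω with hlimdef
  have hlim : ∀ᵐ ω ∂preWienerMeasure, Tendsto (fun n ↦ h n ω) atTop (𝓝 (lim ω)) := by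
    filter_upwards [ae_sleLifetime_lt_top (θ := θ) hκ] with ω hT
    exact (tendsto_sleScale_sleExitLevelValue hκ hθ hT).comp (tendsto_add_atTop_nat N₀)
  -- measurability via the stage-one observables
  have hmeas : ∀ n, AEStronglyMeasurable (h n) preWienerMeasure := by
    intro n
    set m := n + N₀ with hm
    have hθm := hN₀ m (Nat.le_add_left _ _)
    obtain ⟨F, hF, hFeq⟩ := exists_contDiff_sleScale hκ m
    have hFval : ∀ y ∈ Icc (2 * level m) (2 * Real.pi - 2 * level m), F y = sleScale κ y :=
      fun y hy ↦ (hFeq y (Icc_level_subset_Ioo_level m hy)).eq_of_nhds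
    refine aestronglyMeasurable_of_tendsto_ae atTop
      (f := fun (k : ℕ) ω ↦ expClock κ m θ 0 k ω *
        F (stoppedProcess (sleArgLevel κ m θ) (sleExitLevel κ m θ) k ω))
      (fun k ↦ (measurable_expClock_mul hF 0 k).aestronglyMeasurable) ?_
    filter_upwards [ae_sleExitLevel_lt_top hκ m θ] with ω hω
    obtain ⟨s, hs⟩ := WithTop.ne_top_iff_exists.1 hω.ne
    refine tendsto_const_nhds.congr' ?_
    filter_upwards [eventually_stoppedProcess_eq_sleExitLevelValue hs.symm] with k hk
    simp only [hh, hk, expClock_apply, zero_mul, Real.exp_zero, one_mul]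
    have hmem : sleExitLevelValue κ m θ ω ∈ Icc (2 * level m) (2 * Real.pi - 2 * level m) := by
      rcases sleExitLevelValue_eq_or hθm hs.symm with h | h <;> rw [h]
      · exact ⟨le_rfl, by have := level_le_one m; linarith [Real.pi_gt_three]⟩
      · exact ⟨by have := level_le_one m; linarith [Real.pi_gt_three], le_rfl⟩
    exact (hFval _ hmem).symm
  have hbound : ∀ n, ∀ᵐ ω ∂preWienerMeasure, ‖h n ω‖ ≤ C := by
    intro n
    filter_upwards [ae_sleLifetime_lt_top (θ := θ) hκ] with ω hT
    have hσ : sleExitLevel κ (n + N₀) θ ω < ⊤ :=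
      (exitLevel_le_lifetime (continuous_sleDriving' κ) (n + N₀) θ ω).trans_lt hT
    obtain ⟨s, hs⟩ := WithTop.ne_top_iff_exists.1 hσ.ne
    exact hC _ (sleExitLevelValue_mem_Icc (hN₀ (n + N₀) (Nat.le_add_left _ _)) hs.symm)
  have hdct := tendsto_integral_of_dominated_convergence _ hmeas (integrable_const C) hbound hlim
  have hval : ∫ ω, lim ω ∂preWienerMeasure = sleScale κ θ :=
    tendsto_nhds_unique hdct (by simp only [hint]; exact tendsto_const_nhds)
  rw [hlimdef, integral_add ((integrable_const _).indicator (measurableSet_sleExitsTop κ θ))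
    ((integrable_const _).indicator (measurableSet_sleExitsBot κ θ)),
    integral_indicator_const _ (measurableSet_sleExitsTop κ θ),
    integral_indicator_const _ (measurableSet_sleExitsBot κ θ), smul_eq_mul, smul_eq_mul] at hval
  linarith

/-- **The probability of leaving through `2π`**:
`P[Y_T = 2π] = (ψ(θ) - ψ(0)) / (ψ(2π) - ψ(0))` for `κ > 4`, `θ ∈ (0, 2π)` (Lawler (2005),
Lemma 1.25/1.27 for the process (1.16); in particular `0 < P[Y_T = 2π] < 1`).
[cite: Lawler2005, §1.11 Lemma 1.25] -/
theorem measureReal_sleExitsTop_eq (hκ : 4 < κ) (hθ : θ ∈ Ioo 0 (2 * Real.pi)) :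
    preWienerMeasure.real (sleExitsTop κ θ) =
      (sleScale κ θ - sleScale κ 0) / (sleScale κ (2 * Real.pi) - sleScale κ 0) := by
  have h1 := sleScale_mul_measureReal_exits hκ hθ
  have h2 := measureReal_sleExitsTop_add_sleExitsBot hκ hθ
  have hmono := strictMonoOn_sleScale hκ
  have hlt : sleScale κ 0 < sleScale κ (2 * Real.pi) :=
    hmono ⟨le_rfl, by linarith [Real.pi_pos]⟩ ⟨by linarith [Real.pi_pos], le_rfl⟩ (by linarith [Real.pi_pos])
  rw [eq_div_iff (by linarith)]
  have hb : preWienerMeasure.real (sleExitsBot κ θ) = 1 - preWienerMeasure.real (sleExitsTop κ θ) := by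
    linarith
  rw [hb] at h1
  linarith

/-- **Both exits have positive probability** (`κ > 4`, `θ ∈ (0, 2π)`): `0 < P[Y_T = 2π] < 1`
(Lawler (2005), Lemma 1.25: "`P^x{T < ∞; X_T = 0} > 0` if and only if `ψ(0+) > -∞`";
LSW (2002), §4, p. 9). [cite: Lawler2005, §1.11 Lemma 1.25] -/
theorem measureReal_sleExitsTop_mem_Ioo (hκ : 4 < κ) (hθ : θ ∈ Ioo 0 (2 * Real.pi)) :
    preWienerMeasure.real (sleExitsTop κ θ) ∈ Ioo 0 1 := by
  rw [measureReal_sleExitsTop_eq hκ hθ]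
  have hmono := strictMonoOn_sleScale hκ
  have h0θ : sleScale κ 0 < sleScale κ θ :=
    hmono ⟨le_rfl, by linarith [Real.pi_pos]⟩ ⟨hθ.1.le, hθ.2.le⟩ hθ.1
  have hθ2 : sleScale κ θ < sleScale κ (2 * Real.pi) :=
    hmono ⟨hθ.1.le, hθ.2.le⟩ ⟨by linarith [Real.pi_pos], le_rfl⟩ hθ.2
  constructor
  · exact div_pos (by linarith) (by linarith)
  · rw [div_lt_one (by linarith)]; linarith

end RadialLoewner

end Literature.Probability.RandomPlanarGeometry
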